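import Mathlib
import Summits.ValiantsHypothesis.ValiantsHypothesis.Theorems.GrenetZeonPolySizeQPAlgebraOutsideWindow
import HarnessLib

/-!
# Crux `GrenetZeon.PolySizeQPAlgebra` (stmt-ValiantsHypothesis-8064), line `vbp-slice-dealg` —
# the top of the window: residual corank `q` with `𝔪^q = 0` (e.g. `q = ν`)

After `…OutsideWindow` the type-independent input (B) has content only at residual coranks
`3 ≤ q ≤ ν(R)`.  At the TOP of this window, `q = ν` (more generally `𝔪^q = 0`), the closed form of
`…BlockNormalFormGeneral` still simplifies drastically: `det S = 0`, `adj S ∈ 𝔪^{q-1}` kills `𝔪`, and the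
second polarisation has coefficients in `𝔪^{q-2}`, which kill `𝔪²`.  Hence at a normal form
`diag(1_κ, S)`, `S ∈ Mat_q(𝔪)`:

  `rank Hess λ(det A)(p) ≤ 2 + 2·|κ|·q + q² · dim_ℂ(R/𝔪²)`

(`T₁, T₂`: rank `≤ 1` each; `T₃ + T₄`: `2|κ|` read-outs through residues, rank `≤ q` each; `T₅`: factors
through `X mod 𝔪²`).  Since `2·dim R·(|κ| + q) - (2|κ|q + …) = 2|κ|(dim R - q) + …` and `q = ν < dim R`
for every NON-curvilinear type, this is within the budget `2·dim R·n` for all large `n` — so, eventually in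
`n`, the window shrinks to `3 ≤ q ≤ ν - 1`; for `ℂ[x,y]/(x²,y²)` (`ν = 3`, the residual type of the rung
`(n,4)`) NOTHING remains for large `n` once `π` (a `ℂ`-linear projection modulo `𝔪²`, `dim range π = 3`)
is supplied: `2 + 6|κ| + 27 ≤ 8(|κ| + 3)` for `|κ| ≥ 3`.  This file proves the normal-form statement with
the projection `π` as data (`x - π x ∈ 𝔪²`); the point version follows with `…MaximalMinorTransport`.

* `det_eq_zero_of_rows_mem_and_row_mem_sq`, `det_updateRow_eq_of_sub_mem_sq` — replacement of a row modulo
  `𝔪²` when `q - 2` other rows lie in `𝔪` and `𝔪^q = 0`.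
* `mul_eq_residue_smul_of_mem_pow` — `z ∈ 𝔪^a`, `𝔪^{a+1} = 0` ⟹ `z·u = φ(u)·z`.
* `rank_readOut_mul_le_one_of_mem_pow` (`T₁/T₂`), `rank_dotProduct_mulVec_readOut_le_card_of_mem_pow`
  (`T₃/T₄`, rank `≤ q`), `det_mem_pow_of_rows_mem`, `adjugate_apply_mem_pow` (`adj S ∈ 𝔪^{q-1}`),
  `rank_secondPolar_readOut_le_of_top` (`T₅`, rank `≤ q²·dim range π`).
* `rank_hess0_transl_le_of_top_normalForm` — **the bound `2 + 2|κ|q + q²·dim range π` at normal forms of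
  residual corank `q` with `(ker φ)^q = 0`.**

HONEST FRAMING: rank theorems at normal forms; no stub of the line is closed; VP ≠ VNP is not moved.

References: T. Mignon, N. Ressayre, IMRN 2004:79, §2 [MignonRessayre2004].
-/

noncomputable section

open MvPolynomial Matrix
open Literature.Computability.AlgebraicComplexity

-- single-conjunct layout `Summits/ValiantsHypothesis/ValiantsHypothesis`: duplicated namespace by design
set_option linter.dupNamespace false

namespace Summit.ValiantsHypothesis.ValiantsHypothesis.Theorems.GrenetZeonPolySizeQPAlgebra

section TopWindowBricks

variable {R : Type*} [CommRing R] {m : Type*} [Fintype m] [DecidableEq m]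

/-- Rows in `I` and one row in `I²`: if `I^ν = 0`, `q ∉ T`, the rows `r ∈ T` of `M` lie in `I`, row `q`
lies in `I²` and `|T| + 2 ≥ ν`, then `det M = 0`. [folklore] -/
theorem det_eq_zero_of_rows_mem_and_row_mem_sq (I : Ideal R) {ν : ℕ} (hI : I ^ ν = ⊥)
    (M : Matrix m m R) (q : m) (T : Finset m) (hqT : q ∉ T) (hT : ν ≤ T.card + 2)
    (hrows : ∀ r ∈ T, ∀ j, M r j ∈ I) (hq : ∀ j, M q j ∈ I ^ 2) : M.det = 0 := by
  classical
  rw [Matrix.det_apply']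
  refine Finset.sum_eq_zero fun σ _ => ?_
  have hprod : ∏ i, M (σ i) i = 0 := by
    rw [← Equiv.prod_comp σ.symm (fun i => M (σ i) i)]
    simp only [Equiv.apply_symm_apply]
    rw [← Finset.prod_mul_prod_compl (insert q T), Finset.prod_insert hqT]
    have h1 : ∏ r ∈ T, M r (σ.symm r) ∈ I ^ T.card :=
      prod_mem_pow_card I (fun r => M r (σ.symm r)) T fun r hr => hrows r hr _
    have hmem : M q (σ.symm q) * ∏ r ∈ T, M r (σ.symm r) ∈ I ^ (2 + T.card) := by
      rw [pow_add]
      exact Ideal.mul_mem_mul (hq _) h1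
    have h0 : M q (σ.symm q) * ∏ r ∈ T, M r (σ.symm r) ∈ I ^ ν :=
      Ideal.pow_le_pow_right (by omega) hmem
    rw [hI, Ideal.mem_bot] at h0
    rw [h0, zero_mul]
  rw [hprod, mul_zero]

variable [Algebra ℂ R]

/-- **Replacement in a row modulo `𝔪²`.**  If `(ker φ)^ν = 0`, at least `ν - 2` rows of `M` other than
`q` lie in `ker φ`, and `x ≡ x'` entrywise modulo `(ker φ)²`, then replacing row `q` by `x` or by `x'`
gives the same determinant. [folklore] -/
theorem det_updateRow_eq_of_sub_mem_sq (φ : R →ₐ[ℂ] ℂ) {ν : ℕ} (hker : RingHom.ker (φ : R →+* ℂ) ^ ν = ⊥)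
    (M : Matrix m m R) (q : m) (T : Finset m) (hqT : q ∉ T) (hT : ν ≤ T.card + 2)
    (hrows : ∀ r ∈ T, ∀ j, φ (M r j) = 0) (x x' : m → R)
    (hx : ∀ j, x j - x' j ∈ RingHom.ker (φ : R →+* ℂ) ^ 2) :
    (M.updateRow q x).det = (M.updateRow q x').det := by
  classical
  have hsplit : x = x' + (x - x') := by abel
  rw [hsplit, Matrix.det_updateRow_add, add_eq_left]
  refine det_eq_zero_of_rows_mem_and_row_mem_sq (RingHom.ker (φ : R →+* ℂ)) hker _ q T hqT hT
    (fun r hr j => ?_) (fun j => ?_)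
  · rw [Matrix.updateRow_ne (ne_of_mem_of_not_mem hr hqT), RingHom.mem_ker]
    exact hrows r hr j
  · rw [Matrix.updateRow_self]
    exact hx j

omit [Fintype m] [DecidableEq m] in
/-- An element of `(ker φ)^a` times an arbitrary element only sees its residue when `(ker φ)^{a+1} = 0`:
`z · u = φ(u) · z`. [folklore] -/
theorem mul_eq_residue_smul_of_mem_pow (φ : R →ₐ[ℂ] ℂ) {a : ℕ}
    (hker : RingHom.ker (φ : R →+* ℂ) ^ (a + 1) = ⊥) {z : R} (hz : z ∈ RingHom.ker (φ : R →+* ℂ) ^ a)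
    (u : R) : z * u = φ u • z := by
  have hu : u - algebraMap ℂ R (φ u) ∈ RingHom.ker (φ : R →+* ℂ) := by
    rw [RingHom.mem_ker]
    simp
  have h0 : z * (u - algebraMap ℂ R (φ u)) = 0 := by
    have h := Ideal.mul_mem_mul hz hu
    rw [← pow_succ, hker, Ideal.mem_bot] at h
    exact h
  rw [mul_sub, sub_eq_zero] at h0
  rw [h0, Algebra.smul_def, mul_comm]

variable [Module.Finite ℂ R] {σ : Type*} [Fintype σ]

omit [Module.Finite ℂ R] in
/-- **`T₁`/`T₂` brick at the top of the window.**  If `ζ_t ∈ (ker φ)^a` with `(ker φ)^{a+1} = 0` then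
`(s,t) ↦ λ(τ_s ζ_t) = φ(τ_s) λ(ζ_t)` has rank `≤ 1`. [folklore] -/
theorem rank_readOut_mul_le_one_of_mem_pow (φ : R →ₐ[ℂ] ℂ) {a : ℕ}
    (hker : RingHom.ker (φ : R →+* ℂ) ^ (a + 1) = ⊥) (l : R →ₗ[ℂ] ℂ) (τ ζ : σ → R)
    (hζ : ∀ t, ζ t ∈ RingHom.ker (φ : R →+* ℂ) ^ a) :
    (Matrix.of fun s t => l (τ s * ζ t)).rank ≤ 1 := by
  have h : (Matrix.of fun s t => l (τ s * ζ t)) =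
      Matrix.vecMulVec (fun s => φ (τ s)) (fun t => l (ζ t)) := by
    ext s t
    rw [Matrix.of_apply, Matrix.vecMulVec_apply, mul_comm (τ s), mul_eq_residue_smul_of_mem_pow φ hker (hζ t),
      map_smul, smul_eq_mul]
  rw [h]
  exact Matrix.rank_vecMulVec_le _ _

omit [DecidableEq m] [Module.Finite ℂ R] in
/-- **`T₃`/`T₄` brick at the top of the window.**  If all entries of `M` lie in `(ker φ)^a` with
`(ker φ)^{a+1} = 0`, then `(s,t) ↦ λ(x_s · (M y_t))` depends only on the residues of `x_s`, `y_t` and has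
rank `≤ |m|`. [folklore] -/
theorem rank_dotProduct_mulVec_readOut_le_card_of_mem_pow (φ : R →ₐ[ℂ] ℂ) {a : ℕ}
    (hker : RingHom.ker (φ : R →+* ℂ) ^ (a + 1) = ⊥) (l : R →ₗ[ℂ] ℂ) (M : Matrix m m R)
    (hM : ∀ i j, M i j ∈ RingHom.ker (φ : R →+* ℂ) ^ a) (x y : σ → m → R) :
    (Matrix.of fun s t => l (x s ⬝ᵥ M *ᵥ y t)).rank ≤ Fintype.card m := by
  set P : Matrix σ m ℂ := Matrix.of fun s i => φ (x s i) with hP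
  set Q : Matrix m σ ℂ := Matrix.of fun i t => ∑ j, φ (y t j) * l (M i j) with hQ
  have h : (Matrix.of fun s t => l (x s ⬝ᵥ M *ᵥ y t)) = P * Q := by
    ext s t
    rw [Matrix.mul_apply, Matrix.of_apply]
    simp only [hP, hQ, Matrix.of_apply, dotProduct, Matrix.mulVec, Finset.mul_sum, map_sum]
    refine Finset.sum_congr rfl fun i _ => Finset.sum_congr rfl fun j _ => ?_
    rw [mul_comm (x s i), mul_eq_residue_smul_of_mem_pow φ hker (hM i j), smul_mul_assoc,
      mul_eq_residue_smul_of_mem_pow φ hker (hM i j), map_smul, map_smul, smul_eq_mul, smul_eq_mul]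
    ring
  rw [h]
  exact (Matrix.rank_mul_le_left P Q).trans ((Matrix.rank_le_card_width P).trans le_rfl)

end TopWindowBricks

section TopWindowPolar

variable {R : Type*} [CommRing R] {m : Type*} [Fintype m] [DecidableEq m]

/-- Rows in an ideal bound the determinant's depth: if the rows `r ∈ T` of `M` lie in `I` then
`det M ∈ I^{|T|}`. [folklore] -/
theorem det_mem_pow_of_rows_mem (I : Ideal R) (M : Matrix m m R) (T : Finset m)
    (hrows : ∀ r ∈ T, ∀ j, M r j ∈ I) : M.det ∈ I ^ T.card := by
  classical
  rw [Matrix.det_apply']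
  refine Ideal.sum_mem _ fun σ _ => Ideal.mul_mem_left _ _ ?_
  rw [← Equiv.prod_comp σ.symm (fun i => M (σ i) i)]
  simp only [Equiv.apply_symm_apply]
  rw [← Finset.prod_mul_prod_compl T]
  exact Ideal.mul_mem_right _ _ (prod_mem_pow_card I (fun r => M r (σ.symm r)) T fun r hr => hrows r hr _)

/-- The adjugate of a matrix with entries in `I` has entries in `I^{|m|-1}`. [folklore] -/
theorem adjugate_apply_mem_pow (I : Ideal R) (S : Matrix m m R) (hS : ∀ i j, S i j ∈ I) (i j : m) :
    S.adjugate i j ∈ I ^ (Fintype.card m - 1) := by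
  rw [Matrix.adjugate_apply]
  have h := det_mem_pow_of_rows_mem I (S.updateRow j (Pi.single i 1)) (Finset.univ.erase j)
    fun r hr c => by rw [Matrix.updateRow_ne (Finset.mem_erase.1 hr).1]; exact hS _ _
  rwa [Finset.card_erase_of_mem (Finset.mem_univ j), Finset.card_univ] at h

variable [Algebra ℂ R] [Module.Finite ℂ R] {σ : Type*} [Fintype σ]

/-- **`T₅` brick at the top of the window.**  If `(ker φ)^{|m|} = 0`, `S ∈ Mat_m(ker φ)` with `|m| ≥ 3`,
and `π : R → R` is `ℂ`-linear with `x - π x ∈ (ker φ)²` for all `x`, then the second-polarisation read-out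
`(s,t) ↦ λ(Σ_r Σ_{q≠r} det(S | row r ← (Y_t)_r, row q ← (X_s)_q))` depends on `X_s` only through `π(X_s)`,
hence has rank `≤ |m|² · dim range π`. [folklore] -/
theorem rank_secondPolar_readOut_le_of_top (φ : R →ₐ[ℂ] ℂ)
    (hker : RingHom.ker (φ : R →+* ℂ) ^ Fintype.card m = ⊥) (l : R →ₗ[ℂ] ℂ) (S : Matrix m m R)
    (hS : ∀ i j, φ (S i j) = 0) (hm3 : 3 ≤ Fintype.card m) (π : R →ₗ[ℂ] R)
    (hπ : ∀ x, x - π x ∈ RingHom.ker (φ : R →+* ℂ) ^ 2) (Xf Yf : σ → Matrix m m R) :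
    (Matrix.of fun s t => l (∑ r, ∑ q, if q = r then 0 else
        ((S.updateRow r (Yf t r)).updateRow q (Xf s q)).det)).rank ≤
      Fintype.card m * Fintype.card m * Module.finrank ℂ (LinearMap.range π) := by
  classical
  -- replace the row `(X_s)_q` by `π` of it
  have hres : ∀ (r q : m), q ≠ r → ∀ (y x : m → R),
      ((S.updateRow r y).updateRow q x).det = ((S.updateRow r y).updateRow q (fun j => π (x j))).det := by
    intro r q hqr y x
    refine det_updateRow_eq_of_sub_mem_sq φ hker _ q ((Finset.univ.erase r).erase q)
      (fun h => (Finset.mem_erase.1 h).1 rfl) ?_ (fun r' hr' j => ?_) _ _ (fun j => hπ (x j))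
    · have h1 : (Finset.univ.erase r).card = Fintype.card m - 1 := by
        rw [Finset.card_erase_of_mem (Finset.mem_univ r), Finset.card_univ]
      have h3 : ((Finset.univ.erase r).erase q).card ≥ (Finset.univ.erase r).card - 1 :=
        Finset.pred_card_le_card_erase
      omega
    · rw [Matrix.updateRow_ne (Finset.mem_erase.1 (Finset.mem_erase.1 hr').2).1]; exact hS _ _
  -- the functionals on matrices over `range π`
  set V : Submodule ℂ R := LinearMap.range π with hV
  have hadd : ∀ (t : σ) (M N : Matrix m m V),
      (∑ r, ∑ q, if q = r then (0 : R) else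
        ((S.updateRow r (Yf t r)).updateRow q (fun j => ((M + N) q j : R))).det) =
      (∑ r, ∑ q, if q = r then (0 : R) else
        ((S.updateRow r (Yf t r)).updateRow q (fun j => (M q j : R))).det) +
      ∑ r, ∑ q, if q = r then (0 : R) else
        ((S.updateRow r (Yf t r)).updateRow q (fun j => (N q j : R))).det := by
    intro t M N
    rw [← Finset.sum_add_distrib]
    refine Finset.sum_congr rfl fun r _ => ?_
    rw [← Finset.sum_add_distrib]
    refine Finset.sum_congr rfl fun q _ => ?_
    split_ifs with h
    · rw [add_zero]
    · rw [show (fun j => ((M + N) q j : R)) = (fun j => (M q j : R)) + fun j => (N q j : R) by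
        funext j; simp [Matrix.add_apply], Matrix.det_updateRow_add]
  have hsmul : ∀ (t : σ) (a : ℂ) (M : Matrix m m V),
      (∑ r, ∑ q, if q = r then (0 : R) else
        ((S.updateRow r (Yf t r)).updateRow q (fun j => ((a • M) q j : R))).det) =
      algebraMap ℂ R a * ∑ r, ∑ q, if q = r then (0 : R) else
        ((S.updateRow r (Yf t r)).updateRow q (fun j => (M q j : R))).det := by
    intro t a M
    rw [Finset.mul_sum]
    refine Finset.sum_congr rfl fun r _ => ?_
    rw [Finset.mul_sum]
    refine Finset.sum_congr rfl fun q _ => ?_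
    split_ifs with h
    · rw [mul_zero]
    · rw [show (fun j => ((a • M) q j : R)) = algebraMap ℂ R a • fun j => (M q j : R) by
        funext j; simp [Matrix.smul_apply, Algebra.smul_def], Matrix.det_updateRow_smul]
  let ψ : σ → (Matrix m m V →ₗ[ℂ] ℂ) := fun t =>
    { toFun := fun M => l (∑ r, ∑ q, if q = r then 0 else
        ((S.updateRow r (Yf t r)).updateRow q (fun j => (M q j : R))).det)
      map_add' := fun M N => by rw [hadd, map_add]
      map_smul' := fun a M => by rw [hsmul, ← Algebra.smul_def, map_smul, RingHom.id_apply] }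
  set w : σ → Matrix m m V := fun s => Matrix.of fun i j => ⟨π (Xf s i j), LinearMap.mem_range_self π _⟩
    with hw
  have h : (Matrix.of fun s t => l (∑ r, ∑ q, if q = r then 0 else
      ((S.updateRow r (Yf t r)).updateRow q (Xf s q)).det)) = Matrix.of fun s t => ψ t (w s) := by
    ext s t
    simp only [Matrix.of_apply]
    change _ = l _
    congr 1
    refine Finset.sum_congr rfl fun r _ => Finset.sum_congr rfl fun q _ => ?_
    split_ifs with hqr
    · rfl
    · rw [hres r q hqr]
      rfl
  rw [h]
  refine (rank_linear_readOut_le w ψ).trans ?_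
  rw [Module.finrank_matrix ℂ V m m]

end TopWindowPolar

section TopWindowAssembly

variable {R : Type*} [CommRing R] [Algebra ℂ R] [Module.Finite ℂ R] {σ : Type*} [Fintype σ] [DecidableEq σ]
  {κ m : Type*} [Fintype κ] [DecidableEq κ] [Fintype m] [DecidableEq m]

/-- **Top of the window: the local Hessian bound at a normal form of residual corank `q` with `𝔪^q = 0`.**
Let `φ` be a character with `(ker φ)^{|m|} = 0`, `A` affine with `A(p) = diag(1_κ, S)`, `S ∈ Mat_m(ker φ)`,
`|m| ≥ 3`, `F = λ(det A)`, and `π : R → R` a `ℂ`-linear map with `x - π x ∈ (ker φ)²`.  Then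
`rank Hess F(p) ≤ 2 + 2·|κ|·|m| + |m|²·dim range π`: in the closed form of
`eval_pderiv_pderiv_det_blockNormalForm_general`, `det S = 0`, `adj S ∈ 𝔪^{q-1}` kills `𝔪`, so `T₁, T₂`
have rank `≤ 1`, each of the `2|κ|` pieces of `T₃ + T₄` has rank `≤ |m|`, and `T₅` sees `X` only modulo
`𝔪²`. [cite: MignonRessayre2004, §2] -/
theorem rank_hess0_transl_le_of_top_normalForm (φ : R →ₐ[ℂ] ℂ)
    (hker : RingHom.ker (φ : R →+* ℂ) ^ Fintype.card m = ⊥) (l : R →ₗ[ℂ] ℂ)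
    (A : Matrix (κ ⊕ m) (κ ⊕ m) (MvPolynomial σ R)) (F : MvPolynomial σ ℂ)
    (hA : ∀ a b, (A a b).totalDegree ≤ 1) (hF : ∀ d, l (coeff d A.det) = coeff d F)
    (p : σ → ℂ) (S : Matrix m m R)
    (hB : A.map (eval fun i => algebraMap ℂ R (p i)) = Matrix.fromBlocks 1 0 0 S)
    (hS : ∀ i j, φ (S i j) = 0) (hm3 : 3 ≤ Fintype.card m) (π : R →ₗ[ℂ] R)
    (hπ : ∀ x, x - π x ∈ RingHom.ker (φ : R →+* ℂ) ^ 2) :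
    (hess0 (transl p F)).rank ≤ 2 + 2 * Fintype.card κ * Fintype.card m +
      Fintype.card m * Fintype.card m * Module.finrank ℂ (LinearMap.range π) := by
  classical
  have hS' : ∀ i j, S i j ∈ RingHom.ker (φ : R →+* ℂ) := fun i j => by simpa using hS i j
  have hker' : RingHom.ker (φ : R →+* ℂ) ^ (Fintype.card m - 1 + 1) = ⊥ := by
    rwa [Nat.sub_add_cancel (by omega)]
  have hadj : ∀ i j, S.adjugate i j ∈ RingHom.ker (φ : R →+* ℂ) ^ (Fintype.card m - 1) :=
    adjugate_apply_mem_pow _ S hS'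
  set x : σ → R := fun i => algebraMap ℂ R (p i) with hx
  set Xf : σ → Matrix (κ ⊕ m) (κ ⊕ m) R := fun s => A.map fun a => eval x (pderiv s a) with hXf
  -- the pieces
  set τ : σ → R := fun s => (Xf s).toBlocks₁₁.trace with hτ
  set ζ : σ → R := fun s => (S.adjugate * (Xf s).toBlocks₂₂).trace with hζ
  have hζmem : ∀ t, ζ t ∈ RingHom.ker (φ : R →+* ℂ) ^ (Fintype.card m - 1) := by
    intro t
    simp only [hζ, Matrix.trace, Matrix.diag, Matrix.mul_apply]
    exact Ideal.sum_mem _ fun a _ => Ideal.sum_mem _ fun b _ => Ideal.mul_mem_right _ _ (hadj a b)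
  set G₁ : Matrix σ σ ℂ := Matrix.of fun s t => l (τ s * ζ t) with hG₁
  set G₂ : Matrix σ σ ℂ := Matrix.of fun s t => l (τ t * ζ s) with hG₂
  set G₅ : Matrix σ σ ℂ := Matrix.of fun s t => l (∑ r, ∑ q, if q = r then 0 else
    ((S.updateRow r ((Xf t).toBlocks₂₂ r)).updateRow q ((Xf s).toBlocks₂₂ q)).det) with hG₅
  set H₄ : κ → Matrix σ σ ℂ := fun c => Matrix.of fun s t =>
    l ((fun a => (Xf s).toBlocks₁₂ c a) ⬝ᵥ (S.adjugate *ᵥ fun b => (Xf t).toBlocks₂₁ b c)) with hH₄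
  set H₃ : κ → Matrix σ σ ℂ := fun c => (H₄ c)ᵀ with hH₃
  have hH : hess0 (transl p F) = G₁ + G₂ + G₅ + -(∑ c, (H₃ c + H₄ c)) := by
    ext s t
    rw [hess0_transl_readOut l hF p s t,
      eval_pderiv_pderiv_det_blockNormalForm_general x s t A hA S hB (Xf s) (Xf t) rfl rfl,
      det_eq_zero_of_mem_pow _ hker S hS' le_rfl]
    simp only [Matrix.add_apply, Matrix.neg_apply, Matrix.sum_apply, Matrix.transpose_apply, hG₁, hG₂,
      hG₅, hH₃, hH₄, Matrix.of_apply, hτ, hζ]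
    rw [Matrix.mul_neg, Matrix.trace_neg, Matrix.mul_add, Matrix.trace_add,
      trace_mul_mul_eq_sum_dotProduct, trace_mul_mul_eq_sum_dotProduct, mul_zero, add_zero,
      ← Finset.sum_add_distrib]
    simp only [map_add, map_neg, map_sum]
    abel
  -- ranks
  have h1 : G₁.rank ≤ 1 := rank_readOut_mul_le_one_of_mem_pow φ hker' l τ ζ hζmem
  have h2 : G₂.rank ≤ 1 := by
    have : G₂ = G₁ᵀ := by ext s t; rfl
    rw [this, Matrix.rank_transpose]
    exact h1
  have h5 : G₅.rank ≤ Fintype.card m * Fintype.card m * Module.finrank ℂ (LinearMap.range π) :=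
    rank_secondPolar_readOut_le_of_top φ hker l S hS hm3 π hπ _ _
  have h4 : ∀ c, (H₄ c).rank ≤ Fintype.card m := fun c =>
    rank_dotProduct_mulVec_readOut_le_card_of_mem_pow φ hker' l S.adjugate hadj _ _
  have h3 : ∀ c, (H₃ c).rank ≤ Fintype.card m := fun c => by
    rw [hH₃, Matrix.rank_transpose]; exact h4 c
  have h34 : (∑ c, (H₃ c + H₄ c)).rank ≤ Fintype.card κ * (2 * Fintype.card m) := by
    refine (rank_sum_le _ _).trans ?_
    calc ∑ c, (H₃ c + H₄ c).rank ≤ ∑ _c : κ, 2 * Fintype.card m :=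
          Finset.sum_le_sum fun c _ => (rank_add_le _ _).trans (by have := h3 c; have := h4 c; omega)
      _ = _ := by rw [Finset.sum_const, Finset.card_univ, smul_eq_mul]
  rw [hH]
  refine (rank_add_le _ _).trans ?_
  rw [rank_neg_eq]
  refine (Nat.add_le_add (rank_add_le _ _) h34).trans ?_
  have h12 := (rank_add_le G₁ G₂).trans (Nat.add_le_add h1 h2)
  nlinarith [h12, h5]

end TopWindowAssembly

end Summit.ValiantsHypothesis.ValiantsHypothesis.Theorems.GrenetZeonPolySizeQPAlgebra

end
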